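import Summits.QuantumFields.YangMills.Theorems.BalabanUVNodesN13UV01LevelZeroOfNormalisationLettersAtRecord13
import Summits.QuantumFields.YangMills.Theorems.BalabanUVNodesN13GaugeFixingAxialLayers
import Literature.MathematicalPhysics.QuantumFieldTheory.Balaban1983to89.Node00.Record13NumericsOfThm1CCMZ

/-!
# BalabanUVNodes ∕ N13 — [III] Cor. 3 (2.50) AT LEVEL `0` AT A GIBBS-NORMALISED WITNESS (`E(P) = log Z_{T^{(0)}}(g₀⁻²)`, `ρ₀` = the Wilson Gibbs density) and THE GIBBS-NORMALISED
# MEMBER OF DEF-1's Z FAMILY (an explicit value of the open letter `Efl`): level-0 face with NO normalisation item and NO coupling floor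

Cell `pub-ymgap` (D-0062 Track A ∕ D-0149 width), WIDTH SEAT `pub-ymgap-dag-n13-w1` (gen 6, CLAIM-5), key K1⁹ `StabilityBRunRowsAtRecordR13SepCoPHV` = stmt-QuantumFields-27364
(`route-QuantumFields-BalabanUVNodes` rev 29; `--kind proof --supports … --as helper`; count-neutral).  LOCATED FOR THIS LANE by dag-n13-w3 g5 (bus ≈14:5xZ, ■ CLOSE line): «the
GIBBS-NORMALISED choice (`Efl` tuned so that `EOfRecord₁₃ θZ p = log partitionFn (F.P p.K) (p.g0⁻²)` exactly — a legal value of the open letter; then the top-level integrated face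
`e^{−E}Z = 1` holds trivially and … the level-0 UPPER half at such a witness is [the tree's lower bound on `log Z`], the LOWER half is `Z ≤ 1` — yours to type)».  Typed here.

THE POINT.  For ANY Stage-13 parameter with `E(P) = log Z_{T^{(0)}}(g₀⁻²)` along a γ-windowed run (`γ ≤ 1`, so `β₀ = g₀⁻² ≥ 1`): `ρ₀ = e^{−E}·e^{−A∕g₀²} = e^{−A∕g₀²}∕Z`, hence
(§2) UPPER `ρ₀ ≤ Z⁻¹ ≤ exp(ep_Z(g₀)·|T₁^{(0)}|)` by dag-n13-w3's axial-layers LOWER bound on `log Z` (`N13GaugeFixingAxialLayers.log_partitionFn_ge_axialLayers_specialUnitary_d4`: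
`log Z ≥ −(3 + 1∕n₀)|T₁^{(0)}|((N²−1)∕2·log β + C_N) − 128|T₁^{(0)}|`), with `ep_Z(g) = (3 + 1∕n₀)(d(𝔤)·log g⁻¹ + C_N) + 128`, `C_N = N²·log(16π+1) + log((2N+1)∕(4π))`, `n₀ = sites per direction`;
LOWER `χβ₀·e^{−A^η₀∕g₀² − 12g₀⁻²|T₁^{(0)}|} ≤ ρ₀` from `Z ≤ 1` (§1, `e^{−βA} ≤ 1` against the product Haar probability) through p586609's `uv_lower_zero_of_E_le` with `em = 0`.  §3: in DEF-1's Z family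
`theta13OfThm1CCMWZ … Efl logz` (Z2 p639492) the β-functions ∕ histories ∕ species do not read the letters (k0 lanes' `rfl` bridges, imported), so the EXPLICIT open-letter value
`Efl_P(i) := 𝟙[i=0]·log Z_{T^{(0)}}(g₀⁻²) − (d(𝔤)·log g_i·|T^{(i)*}| + log σ₀·|T^{(i)*}| − logz_P(i)·(L⁴−1)|T₁^{(i+1)}|)` (any `logz`) makes every (1.15) one-step expression collapse to `𝟙[i=0]·log Z`, i.e.
`E(P) = log Z` on every run with `K ≥ 1` — a NON-coupling-blind member (its `Efl_P(0) ≍ −(3∕2)d(𝔤)|T₁^{(0)}|·log β₀`) with its level-0 face AND the top-level integrated face (`e^{−E}Z = 1`,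
dag-n13-w3's window p625602) in hand.

CONTENTS.  §1 `partitionFn_SU_le_one`, `log_partitionFn_SU_nonpos`.  §2 ★★ `uv_zero_densOfRecord₁₃_of_gibbs` (generic θ, hypothesis `E(P) = log Z`).  §3 ★ `EOfRecord₁₃_theta13OfThm1CCMWZ_gibbs`
(`K ≥ 1 ⟹ E(P) = log Z` at the Gibbs member), ★★ `uv_zero_densOfRecord₁₃_theta13OfThm1CCMWZ_gibbs` (both sides of (2.50) at `k = 0` there; hypotheses: window `γ' ≤ 1`, `K ≥ 1` — nothing else).

HONEST FRAMING.  Real arithmetic + `Z ≤ 1` + by-name use of the tree's `log Z` lower bound; LEVEL 0 only; the Gibbs `Efl` is a legal value of an OPEN letter, NOT Bałaban's `E_k`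
(print's `E` is generated scale by scale by the small-field steps); nothing of Bałaban's Cor. 3 above level 0 asserted; the member is NOT thereby a K1⁹ witness ((2.50) a.e. at levels ≥ 1,
[II] Theorem 1's clause, provisos, rows, END untouched); FLAG №9 NOT closed by this file; K1⁹ NEITHER proved NOR refuted; N13 NOT discharged; counts unmoved (typed 28∕28 · discharged
5∕27 · A 5∕28); one finite `𝕋⁴_{L^K}` programme at fixed ε; R4 closes the CONDITIONAL finite-𝕋⁴ rung `BalabanLadder.UV` only — the Yang–Mills mass gap (Clay) is NOT proved by any of this.
No `sorry`, `def`, `instance`, `notation`; standard axioms.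
-/

noncomputable section

open scoped BigOperators

namespace Summit.QuantumFields.YangMills.BalabanUVNodes.N13UV01LevelZeroGibbsNormalised

open MeasureTheory
open Literature.MathematicalPhysics.QuantumFieldTheory.Balaban1983to89
open Literature.MathematicalPhysics.QuantumFieldTheory.Balaban1983to89.T4Continuum
open Literature.MathematicalPhysics.QuantumFieldTheory.Balaban1983to89.Node00
open Literature.MathematicalPhysics.QuantumFieldTheory.Balaban1983to89.FlowStepRuns (genFlow genSeq genSeq_zero)
open Literature.MathematicalPhysics.QuantumFieldTheory.Balaban1983to89.Missing
open Summit.QuantumFields.YangMills.BalabanUVNodes.N13UV01LevelZeroAtRecord13 (uv_upper_zero_of_negE_le uv_lower_zero_of_E_le)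
open Summit.QuantumFields.YangMills.BalabanUVNodes.N13GaugeFixingAxialLayers (log_partitionFn_ge_axialLayers_specialUnitary_d4)

variable {F : T4Family} {N : ℕ} [NeZero N]

/-! ## §1 `Z ≤ 1` -/

/-- **`Z_{T^{(0)}}(β) ≤ 1` for `β ≥ 0`**: the Boltzmann weight `e^{−βA}` is `≤ 1` (`A ≥ 0`) against the product Haar probability measure. [folklore] -/
theorem partitionFn_SU_le_one (K : ℕ) {β : ℝ} (hβ : 0 ≤ β) : partitionFn (G := SU N) (F.P K) β ≤ 1 := by
  haveI := isProbabilityMeasure_fieldMeasure (G := SU N) (F.P K) 0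
  unfold partitionFn
  calc ∫ U, boltzmann (F.P K) β U ∂fieldMeasure (F.P K) 0 (SU N)
      ≤ ∫ _U, (1 : ℝ) ∂fieldMeasure (F.P K) 0 (SU N) :=
        integral_mono (integrable_boltzmann RegularGaugeGroup.measurable_reTr (F.P K) hβ) (integrable_const 1)
          fun U => boltzmann_le_one (F.P K) hβ U
    _ = 1 := by simp

/-- `log Z_{T^{(0)}}(β) ≤ 0` for `β ≥ 0`. [folklore] -/
theorem log_partitionFn_SU_nonpos (K : ℕ) {β : ℝ} (hβ : 0 ≤ β) : Real.log (partitionFn (G := SU N) (F.P K) β) ≤ 0 :=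
  Real.log_nonpos (partitionFn_pos' (G := SU N) (F.P K) hβ).le (partitionFn_SU_le_one K hβ)

/-! ## §2 (2.50) at level `0` at a GIBBS-NORMALISED Stage-13 parameter: `E(P) = log Z_{T^{(0)}}(g₀⁻²)` -/

section Gibbs

variable (θ : Stage13Params F N) (P : B12.RunParams)

/-- ★★ **(2.50) AT LEVEL `0` AT A GIBBS-NORMALISED WITNESS** — a Stage-13 parameter whose normalisation along the run `P` is `E(P) = log Z_{T^{(0)}}(g₀⁻²)` (so `ρ₀ = e^{−A∕g₀²}∕Z`, the Wilson
GIBBS density): on a γ-windowed run with `γ ≤ 1` (`β₀ = g₀⁻² ≥ 1`), `χβ₀·exp(−g₀⁻²A^η₀ − 12g₀⁻²·|T₁^{(0)}|) ≤ ρ₀ ≤ exp(ep_Z(g₀)·|T₁^{(0)}|)` with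
`ep_Z(g) = (3 + 1∕n₀)·(d(𝔤)·log g⁻¹ + N²·log(16π+1) + log((2N+1)∕(4π))) + 128` (`n₀ = |T₁^{(0)}|` per direction) — LOWER from `Z ≤ 1`, UPPER from dag-n13-w3's axial-layers lower bound
`log_partitionFn_ge_axialLayers_specialUnitary_d4`.  NO coupling floor, NO z∕Efl item. [cite: Balaban1989LargeFieldII, (0.1) pp.355–356; Balaban1988Convergent, Cor. 3 (2.50) p.264, Thm 1 p.262] -/
theorem uv_zero_densOfRecord₁₃_of_gibbs {γ : ℝ} (hγ : γ ≤ 1) (hI : (genFlow (betaOfRecord₁₃ F N θ) P.g0).InInterval γ P.K)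
    (hE : EOfRecord₁₃ F N θ P = Real.log (partitionFn (G := SU N) (F.P P.K) (P.g0⁻¹ ^ 2))) (U : GaugeField (F.P P.K) 0 (SU N)) :
    chiβOfRecord₁₃ F N θ P.K (gOfRecord₁₃ F N θ P) 0 U *
          Real.exp (-(1 / (gOfRecord₁₃ F N θ P 0)) ^ 2 * wilsonBGOfRecord F N θ.εbg P 0 U - (0 + 12 * (1 / gOfRecord₁₃ F N θ P 0) ^ 2) * (Fintype.card (Site (F.P P.K) 0) : ℝ)) ≤
        densOfRecord₁₃ F N θ P 0 U ∧
      densOfRecord₁₃ F N θ P 0 U ≤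
        Real.exp (((3 + ((F.P P.K).sitesPerDir 0 : ℝ)⁻¹) *
            (((dimSU N : ℕ) : ℝ) * Real.log (gOfRecord₁₃ F N θ P 0)⁻¹ + (((N * N : ℕ) : ℝ) * Real.log (16 * Real.pi + 1) + Real.log ((2 * N + 1) / (4 * Real.pi)))) + 128)
          * (Fintype.card (Site (F.P P.K) 0) : ℝ)) := by
  have hg0 : gOfRecord₁₃ F N θ P 0 = P.g0 := genSeq_zero _ _
  have hg0pos : 0 < P.g0 := hg0 ▸ (hI 0 (Nat.zero_le _)).1
  have hg0le : P.g0 ≤ 1 := hg0 ▸ ((hI 0 (Nat.zero_le _)).2.trans hγ)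
  have hβ : 1 ≤ P.g0⁻¹ ^ 2 := by
    have h1 : 1 ≤ P.g0⁻¹ := (one_le_inv₀ hg0pos).mpr hg0le
    nlinarith
  refine ⟨?_, ?_⟩
  · have h := uv_lower_zero_of_E_le θ P (em := 0) (by rw [hE, zero_mul]; exact log_partitionFn_SU_nonpos P.K (by positivity)) U
    rw [hg0] at h ⊢
    exact h
  · rw [hg0]
    refine uv_upper_zero_of_negE_le θ P ?_ U
    rw [hE]
    have hZ := log_partitionFn_ge_axialLayers_specialUnitary_d4 N (F.P P.K) (by simp) hβ
    have hd : ((dimSU N : ℕ) : ℝ) = ((N * N : ℕ) : ℝ) - 1 := N13NormalisationNoGoCouplingBlindAtRecord13SepCoPHV.dimSU_cast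
    have hlog : Real.log (P.g0⁻¹ ^ 2) = 2 * Real.log P.g0⁻¹ := by rw [Real.log_pow]; norm_num
    rw [hlog] at hZ
    rw [hd]
    have : ((((N * N : ℕ) : ℝ) - 1) / 2 * (2 * Real.log P.g0⁻¹)) = (((N * N : ℕ) : ℝ) - 1) * Real.log P.g0⁻¹ := by ring
    rw [this] at hZ
    linarith

end Gibbs

/-! ## §3 THE GIBBS-NORMALISED MEMBER OF DEF-1's Z FAMILY: an explicit open-letter value `Efl` with `E(P) = log Z_{T^{(0)}}(g₀⁻²)` on every run with `K ≥ 1` -/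

section ZFamily

variable (F N) (j : ℕ) (γ ε₀ ε₂₉ B₃ B₃' a₀ a₁ : ℝ) (logz : B12.RunParams → ℕ → ℝ)

/-- ★ **THE GIBBS CHOICE OF THE OPEN LETTER `Efl`** (any `logz`): with `Efl_P(i) := 𝟙[i = 0]·log Z_{T^{(0)}}(g₀⁻²) − (d(𝔤)·log g_i·|T^{(i)*}| + log σ₀·|T^{(i)*}| − logz_P(i)·(L⁴−1)|T₁^{(i+1)}|)`
(the blind member's history `g_i` — the Z member's own by the k0 lanes' `rfl` bridges), every one-step expression (1.15) of the Z member `theta13OfThm1CCMWZ … Efl logz` collapses to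
`𝟙[i = 0]·log Z`, so `E(P) = log Z_{T^{(0)}}(g₀⁻²)` on every run with `K ≥ 1`: `ρ₀ = e^{−A∕g₀²}∕Z` is the Wilson GIBBS density (dag-n13-w3 g5's «Gibbs-normalised choice», bus 14:5xZ).
A legal value of an open letter; NOT print's `E_k`. [cite: Balaban1988Convergent, Thm 1 p.262, (1.15) p.249 (the shape of `E`)] -/
theorem EOfRecord₁₃_theta13OfThm1CCMWZ_gibbs (P : B12.RunParams) (hK : 1 ≤ P.K) :
    EOfRecord₁₃ F N (theta13OfThm1CCMWZ F N j γ ε₀ ε₂₉ B₃ B₃' a₀ a₁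
        (fun p i => (if i = 0 then Real.log (partitionFn (G := SU N) (F.P p.K) (p.g0⁻¹ ^ 2)) else 0) -
            (Real.log (gOfRecord₁₃ F N (theta13OfThm1CCMW F N j γ ε₀ ε₂₉ B₃ B₃' a₀ a₁) p i) * (dimSU N : ℕ) * tstarCount (F.P p.K) i +
              (numerics7OfThm1CCM F.L j ε₀ B₃ B₃' a₀ a₁).logσ₀ * tstarCount (F.P p.K) i - logz p i * ((((F.P p.K).L : ℝ) ^ 4 - 1) * sitesCard (F.P p.K) (i + 1)))) logz) P =
      Real.log (partitionFn (G := SU N) (F.P P.K) (P.g0⁻¹ ^ 2)) := by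
  have hE : EOfRecord₁₃ F N (theta13OfThm1CCMWZ F N j γ ε₀ ε₂₉ B₃ B₃' a₀ a₁
        (fun p i => (if i = 0 then Real.log (partitionFn (G := SU N) (F.P p.K) (p.g0⁻¹ ^ 2)) else 0) -
            (Real.log (gOfRecord₁₃ F N (theta13OfThm1CCMW F N j γ ε₀ ε₂₉ B₃ B₃' a₀ a₁) p i) * (dimSU N : ℕ) * tstarCount (F.P p.K) i +
              (numerics7OfThm1CCM F.L j ε₀ B₃ B₃' a₀ a₁).logσ₀ * tstarCount (F.P p.K) i - logz p i * ((((F.P p.K).L : ℝ) ^ 4 - 1) * sitesCard (F.P p.K) (i + 1)))) logz) P =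
      ∑ i ∈ Finset.range P.K, (if i = 0 then Real.log (partitionFn (G := SU N) (F.P P.K) (P.g0⁻¹ ^ 2)) else 0) := by
    refine Finset.sum_congr rfl fun i _ => ?_
    unfold eStepOfRecord
    change Real.log (gOfRecord₁₃ F N (theta13OfThm1CCMW F N j γ ε₀ ε₂₉ B₃ B₃' a₀ a₁) P i) * (dimSU N : ℕ) * tstarCount (F.P P.K) i +
        (numerics7OfThm1CCM F.L j ε₀ B₃ B₃' a₀ a₁).logσ₀ * tstarCount (F.P P.K) i - logz P i * ((((F.P P.K).L : ℝ) ^ 4 - 1) * sitesCard (F.P P.K) (i + 1)) +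
        ((if i = 0 then Real.log (partitionFn (G := SU N) (F.P P.K) (P.g0⁻¹ ^ 2)) else 0) -
          (Real.log (gOfRecord₁₃ F N (theta13OfThm1CCMW F N j γ ε₀ ε₂₉ B₃ B₃' a₀ a₁) P i) * (dimSU N : ℕ) * tstarCount (F.P P.K) i +
            (numerics7OfThm1CCM F.L j ε₀ B₃ B₃' a₀ a₁).logσ₀ * tstarCount (F.P P.K) i - logz P i * ((((F.P P.K).L : ℝ) ^ 4 - 1) * sitesCard (F.P P.K) (i + 1)))) = _
    ring
  rw [hE, Finset.sum_ite_eq' (Finset.range P.K) 0, if_pos (Finset.mem_range.mpr hK)]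

/-- ★★ **(2.50) AT LEVEL `0` AT THE GIBBS-NORMALISED Z MEMBER — NO ITEM, NO COUPLING FLOOR**: along every γ'-windowed run with `γ' ≤ 1` and `K ≥ 1`, both sides with `em = 12g₀⁻²`,
`ep = ep_Z(g₀)` of §2.  A NON-coupling-blind member of DEF-1's family (its `Efl_P(0)` carries `log Z_{T^{(0)}}(g₀⁻²) ≍ −(3∕2)d(𝔤)|T₁^{(0)}|·log β₀`) whose level-0 face and whose TOP-LEVEL
INTEGRATED FACE (`e^{−E}·Z = 1`, dag-n13-w3's normalisation window p625602 met with room) both hold.  Does NOT make it a K1⁹ witness ((2.50) at levels ≥ 1, Thm 1's clause, provisos, rows, END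
untouched). [cite: Balaban1989LargeFieldII, (0.1) pp.355–356; Balaban1988Convergent, Cor. 3 (2.50) p.264, Thm 1 p.262] -/
theorem uv_zero_densOfRecord₁₃_theta13OfThm1CCMWZ_gibbs (P : B12.RunParams) (hK : 1 ≤ P.K) {γ' : ℝ} (hγ' : γ' ≤ 1)
    (hI : (genFlow (betaOfRecord₁₃ F N (theta13OfThm1CCMW F N j γ ε₀ ε₂₉ B₃ B₃' a₀ a₁)) P.g0).InInterval γ' P.K) (U : GaugeField (F.P P.K) 0 (SU N)) :
    chiβOfRecord₁₃ F N (theta13OfThm1CCMW F N j γ ε₀ ε₂₉ B₃ B₃' a₀ a₁) P.K (gOfRecord₁₃ F N (theta13OfThm1CCMW F N j γ ε₀ ε₂₉ B₃ B₃' a₀ a₁) P) 0 U *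
          Real.exp (-(1 / (gOfRecord₁₃ F N (theta13OfThm1CCMW F N j γ ε₀ ε₂₉ B₃ B₃' a₀ a₁) P 0)) ^ 2 *
              wilsonBGOfRecord F N (theta13OfThm1CCMW F N j γ ε₀ ε₂₉ B₃ B₃' a₀ a₁).εbg P 0 U
            - (0 + 12 * (1 / gOfRecord₁₃ F N (theta13OfThm1CCMW F N j γ ε₀ ε₂₉ B₃ B₃' a₀ a₁) P 0) ^ 2) * (Fintype.card (Site (F.P P.K) 0) : ℝ)) ≤
        densOfRecord₁₃ F N (theta13OfThm1CCMWZ F N j γ ε₀ ε₂₉ B₃ B₃' a₀ a₁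
          (fun p i => (if i = 0 then Real.log (partitionFn (G := SU N) (F.P p.K) (p.g0⁻¹ ^ 2)) else 0) -
            (Real.log (gOfRecord₁₃ F N (theta13OfThm1CCMW F N j γ ε₀ ε₂₉ B₃ B₃' a₀ a₁) p i) * (dimSU N : ℕ) * tstarCount (F.P p.K) i +
              (numerics7OfThm1CCM F.L j ε₀ B₃ B₃' a₀ a₁).logσ₀ * tstarCount (F.P p.K) i - logz p i * ((((F.P p.K).L : ℝ) ^ 4 - 1) * sitesCard (F.P p.K) (i + 1)))) logz) P 0 U ∧
      densOfRecord₁₃ F N (theta13OfThm1CCMWZ F N j γ ε₀ ε₂₉ B₃ B₃' a₀ a₁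
          (fun p i => (if i = 0 then Real.log (partitionFn (G := SU N) (F.P p.K) (p.g0⁻¹ ^ 2)) else 0) -
            (Real.log (gOfRecord₁₃ F N (theta13OfThm1CCMW F N j γ ε₀ ε₂₉ B₃ B₃' a₀ a₁) p i) * (dimSU N : ℕ) * tstarCount (F.P p.K) i +
              (numerics7OfThm1CCM F.L j ε₀ B₃ B₃' a₀ a₁).logσ₀ * tstarCount (F.P p.K) i - logz p i * ((((F.P p.K).L : ℝ) ^ 4 - 1) * sitesCard (F.P p.K) (i + 1)))) logz) P 0 U ≤
        Real.exp (((3 + ((F.P P.K).sitesPerDir 0 : ℝ)⁻¹) *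
            (((dimSU N : ℕ) : ℝ) * Real.log (gOfRecord₁₃ F N (theta13OfThm1CCMW F N j γ ε₀ ε₂₉ B₃ B₃' a₀ a₁) P 0)⁻¹ +
              (((N * N : ℕ) : ℝ) * Real.log (16 * Real.pi + 1) + Real.log ((2 * N + 1) / (4 * Real.pi)))) + 128)
          * (Fintype.card (Site (F.P P.K) 0) : ℝ)) :=
  uv_zero_densOfRecord₁₃_of_gibbs (theta13OfThm1CCMWZ F N j γ ε₀ ε₂₉ B₃ B₃' a₀ a₁
    (fun p i => (if i = 0 then Real.log (partitionFn (G := SU N) (F.P p.K) (p.g0⁻¹ ^ 2)) else 0) -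
            (Real.log (gOfRecord₁₃ F N (theta13OfThm1CCMW F N j γ ε₀ ε₂₉ B₃ B₃' a₀ a₁) p i) * (dimSU N : ℕ) * tstarCount (F.P p.K) i +
              (numerics7OfThm1CCM F.L j ε₀ B₃ B₃' a₀ a₁).logσ₀ * tstarCount (F.P p.K) i - logz p i * ((((F.P p.K).L : ℝ) ^ 4 - 1) * sitesCard (F.P p.K) (i + 1)))) logz) P hγ' hI (EOfRecord₁₃_theta13OfThm1CCMWZ_gibbs F N j γ ε₀ ε₂₉ B₃ B₃' a₀ a₁ logz P hK) U

end ZFamily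

/-! ## §4 (v1.1, append-only) EVERY run, including `K = 0`: there `E(P) = 0` (empty sum) and `ρ₀ = e^{−A∕g₀²}` — level `0` holds with the same exponents -/

section AllRuns

variable (θ : Stage13Params F N) (P : B12.RunParams)

/-- **ON A RUN WITH `K = 0` THE NORMALISATION IS `E(P) = 0`** (the sum over `j < K` is empty), at EVERY Stage-13 parameter. [cite: Balaban1988Convergent, Thm 1 p.262, (1.15) p.249 (bookkeeping)] -/
theorem EOfRecord₁₃_eq_zero_of_K_zero (hK : P.K = 0) : EOfRecord₁₃ F N θ P = 0 := by
  show ∑ j ∈ Finset.range P.K, _ = 0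
  rw [hK, Finset.range_zero, Finset.sum_empty]

/-- **(2.50) AT LEVEL `0` ON A RUN WITH `K = 0`** (any couplings): `ρ₀ = e^{−A∕g₀²}`, so the lower half holds with `em = 0` (+`12g₀⁻²`) and the upper half with ANY `ep ≥ 0`. [cite: Balaban1989LargeFieldII, (0.1) pp.355–356 (bookkeeping)] -/
theorem uv_zero_densOfRecord₁₃_of_K_zero (hK : P.K = 0) {ep : ℝ} (hep : 0 ≤ ep)
    (U : GaugeField (F.P P.K) 0 (SU N)) :
    chiβOfRecord₁₃ F N θ P.K (gOfRecord₁₃ F N θ P) 0 U *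
          Real.exp (-(1 / (gOfRecord₁₃ F N θ P 0)) ^ 2 * wilsonBGOfRecord F N θ.εbg P 0 U - (0 + 12 * (1 / gOfRecord₁₃ F N θ P 0) ^ 2) * (Fintype.card (Site (F.P P.K) 0) : ℝ)) ≤
        densOfRecord₁₃ F N θ P 0 U ∧
      densOfRecord₁₃ F N θ P 0 U ≤ Real.exp (ep * (Fintype.card (Site (F.P P.K) 0) : ℝ)) := by
  have hg0 : gOfRecord₁₃ F N θ P 0 = P.g0 := genSeq_zero _ _
  have hE := EOfRecord₁₃_eq_zero_of_K_zero θ P hK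
  refine ⟨?_, uv_upper_zero_of_negE_le θ P (by rw [hE, neg_zero]; positivity) U⟩
  have h := uv_lower_zero_of_E_le θ P (em := 0) (by rw [hE, zero_mul]) U
  rw [hg0] at h ⊢
  exact h

end AllRuns

section ZFamilyAllRuns

variable (F N) (j : ℕ) (γ ε₀ ε₂₉ B₃ B₃' a₀ a₁ : ℝ) (logz : B12.RunParams → ℕ → ℝ)

/-- ★★ **(2.50) AT LEVEL `0` AT THE GIBBS-NORMALISED Z MEMBER ON EVERY γ'-WINDOWED RUN** (`γ' ≤ 1`; no `K ≥ 1` hypothesis): for `K ≥ 1` §3, for `K = 0` §4's `E = 0` case (`ep_Z(g₀) ≥ 0` since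
`log g₀⁻¹ ≥ 0` and `C_N = N²·log(16π+1) + log((2N+1)∕(4π)) ≥ 0`).  This is the full level-`0` conjunct of `B16.Cor3With` at that member, every run. [cite: Balaban1989LargeFieldII, (0.1) pp.355–356; Balaban1988Convergent, Cor. 3 (2.50) p.264] -/
theorem uv_zero_densOfRecord₁₃_theta13OfThm1CCMWZ_gibbs_allRuns (P : B12.RunParams) {γ' : ℝ} (hγ' : γ' ≤ 1)
    (hI : (genFlow (betaOfRecord₁₃ F N (theta13OfThm1CCMW F N j γ ε₀ ε₂₉ B₃ B₃' a₀ a₁)) P.g0).InInterval γ' P.K) (U : GaugeField (F.P P.K) 0 (SU N)) :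
    chiβOfRecord₁₃ F N (theta13OfThm1CCMW F N j γ ε₀ ε₂₉ B₃ B₃' a₀ a₁) P.K (gOfRecord₁₃ F N (theta13OfThm1CCMW F N j γ ε₀ ε₂₉ B₃ B₃' a₀ a₁) P) 0 U *
          Real.exp (-(1 / (gOfRecord₁₃ F N (theta13OfThm1CCMW F N j γ ε₀ ε₂₉ B₃ B₃' a₀ a₁) P 0)) ^ 2 *
              wilsonBGOfRecord F N (theta13OfThm1CCMW F N j γ ε₀ ε₂₉ B₃ B₃' a₀ a₁).εbg P 0 U
            - (0 + 12 * (1 / gOfRecord₁₃ F N (theta13OfThm1CCMW F N j γ ε₀ ε₂₉ B₃ B₃' a₀ a₁) P 0) ^ 2) * (Fintype.card (Site (F.P P.K) 0) : ℝ)) ≤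
        densOfRecord₁₃ F N (theta13OfThm1CCMWZ F N j γ ε₀ ε₂₉ B₃ B₃' a₀ a₁
          (fun p i => (if i = 0 then Real.log (partitionFn (G := SU N) (F.P p.K) (p.g0⁻¹ ^ 2)) else 0) -
            (Real.log (gOfRecord₁₃ F N (theta13OfThm1CCMW F N j γ ε₀ ε₂₉ B₃ B₃' a₀ a₁) p i) * (dimSU N : ℕ) * tstarCount (F.P p.K) i +
              (numerics7OfThm1CCM F.L j ε₀ B₃ B₃' a₀ a₁).logσ₀ * tstarCount (F.P p.K) i - logz p i * ((((F.P p.K).L : ℝ) ^ 4 - 1) * sitesCard (F.P p.K) (i + 1)))) logz) P 0 U ∧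
      densOfRecord₁₃ F N (theta13OfThm1CCMWZ F N j γ ε₀ ε₂₉ B₃ B₃' a₀ a₁
          (fun p i => (if i = 0 then Real.log (partitionFn (G := SU N) (F.P p.K) (p.g0⁻¹ ^ 2)) else 0) -
            (Real.log (gOfRecord₁₃ F N (theta13OfThm1CCMW F N j γ ε₀ ε₂₉ B₃ B₃' a₀ a₁) p i) * (dimSU N : ℕ) * tstarCount (F.P p.K) i +
              (numerics7OfThm1CCM F.L j ε₀ B₃ B₃' a₀ a₁).logσ₀ * tstarCount (F.P p.K) i - logz p i * ((((F.P p.K).L : ℝ) ^ 4 - 1) * sitesCard (F.P p.K) (i + 1)))) logz) P 0 U ≤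
        Real.exp (((3 + ((F.P P.K).sitesPerDir 0 : ℝ)⁻¹) *
            (((dimSU N : ℕ) : ℝ) * Real.log (gOfRecord₁₃ F N (theta13OfThm1CCMW F N j γ ε₀ ε₂₉ B₃ B₃' a₀ a₁) P 0)⁻¹ +
              (((N * N : ℕ) : ℝ) * Real.log (16 * Real.pi + 1) + Real.log ((2 * N + 1) / (4 * Real.pi)))) + 128)
          * (Fintype.card (Site (F.P P.K) 0) : ℝ)) := by
  rcases Nat.eq_zero_or_pos P.K with hK | hK
  · -- `K = 0`: `E = 0`; the Gibbs exponent is non-negative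
    have hg := hI 0 (Nat.zero_le _)
    have hg1 : gOfRecord₁₃ F N (theta13OfThm1CCMW F N j γ ε₀ ε₂₉ B₃ B₃' a₀ a₁) P 0 ≤ 1 := hg.2.trans hγ'
    have hlog : 0 ≤ Real.log (gOfRecord₁₃ F N (theta13OfThm1CCMW F N j γ ε₀ ε₂₉ B₃ B₃' a₀ a₁) P 0)⁻¹ :=
      Real.log_nonneg ((one_le_inv₀ hg.1).mpr hg1)
    have hN1 : (1 : ℝ) ≤ N := by exact_mod_cast Nat.pos_of_ne_zero (NeZero.ne N)
    have hNN : (1 : ℝ) ≤ ((N * N : ℕ) : ℝ) := by push_cast; nlinarith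
    have hπ := Real.pi_pos
    have hπ3 := Real.pi_gt_three
    have hC : 0 ≤ ((N * N : ℕ) : ℝ) * Real.log (16 * Real.pi + 1) + Real.log ((2 * N + 1) / (4 * Real.pi)) := by
      have h1 : 0 ≤ Real.log (16 * Real.pi + 1) := Real.log_nonneg (by linarith)
      have hA : Real.log (16 * Real.pi + 1) ≤ ((N * N : ℕ) : ℝ) * Real.log (16 * Real.pi + 1) := le_mul_of_one_le_left h1 hNN
      have hB : Real.log (3 / (4 * Real.pi)) ≤ Real.log ((2 * N + 1) / (4 * Real.pi)) :=
        Real.log_le_log (by positivity) (div_le_div_of_nonneg_right (by linarith) (by positivity))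
      have hprod : (1 : ℝ) ≤ (16 * Real.pi + 1) * (3 / (4 * Real.pi)) := by
        rw [← mul_div_assoc, le_div_iff₀ (by positivity)]; nlinarith
      have hsum : 0 ≤ Real.log (16 * Real.pi + 1) + Real.log (3 / (4 * Real.pi)) := by
        rw [← Real.log_mul (by positivity) (by positivity)]; exact Real.log_nonneg hprod
      linarith
    have hep : 0 ≤ (3 + ((F.P P.K).sitesPerDir 0 : ℝ)⁻¹) *
        (((dimSU N : ℕ) : ℝ) * Real.log (gOfRecord₁₃ F N (theta13OfThm1CCMW F N j γ ε₀ ε₂₉ B₃ B₃' a₀ a₁) P 0)⁻¹ +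
          (((N * N : ℕ) : ℝ) * Real.log (16 * Real.pi + 1) + Real.log ((2 * N + 1) / (4 * Real.pi)))) + 128 :=
      add_nonneg (mul_nonneg (by positivity) (add_nonneg (mul_nonneg (Nat.cast_nonneg _) hlog) hC)) (by norm_num)
    exact uv_zero_densOfRecord₁₃_of_K_zero (theta13OfThm1CCMWZ F N j γ ε₀ ε₂₉ B₃ B₃' a₀ a₁
      (fun p i => (if i = 0 then Real.log (partitionFn (G := SU N) (F.P p.K) (p.g0⁻¹ ^ 2)) else 0) -
            (Real.log (gOfRecord₁₃ F N (theta13OfThm1CCMW F N j γ ε₀ ε₂₉ B₃ B₃' a₀ a₁) p i) * (dimSU N : ℕ) * tstarCount (F.P p.K) i +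
              (numerics7OfThm1CCM F.L j ε₀ B₃ B₃' a₀ a₁).logσ₀ * tstarCount (F.P p.K) i - logz p i * ((((F.P p.K).L : ℝ) ^ 4 - 1) * sitesCard (F.P p.K) (i + 1)))) logz) P hK hep U
  · exact uv_zero_densOfRecord₁₃_theta13OfThm1CCMWZ_gibbs F N j γ ε₀ ε₂₉ B₃ B₃' a₀ a₁ logz P hK hγ' hI U

end ZFamilyAllRuns

end Summit.QuantumFields.YangMills.BalabanUVNodes.N13UV01LevelZeroGibbsNormalised
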